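import Summits.ResolutionOfSingularities.ResolutionOfSingularities.Theorems.HomologicalConductorNoZenoBirthDefs
import Literature.AlgebraicGeometry.Resolution.CompositeValuations
import HarnessLib

/-!
# Crux `NoZenoR` / `NoZeno` (stmt-ResolutionOfSingularities-19943 / -16483) — DIRECTIONAL DESCENT below a prime divisor

Route `ResolutionOfSingularities/HomologicalConductor`, W4.4 chain, line `thread-composite` r1 (author res-L0-w44-strat-1
g12, `L/res-L0-w44-strat-1/line-thread-composite-r1.lean` 6346627f182982ad §1b, CHAIN v23 (ρ37d)): the TREE HOME of its
proved «DIRECTIONAL DESCENT» bookkeeping, DEF-FREE (the line's `DropsAlong O A W` unfolds verbatim to the hypothesis `hW`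
below).  OURS (cell res-hironaka): AI-produced and kernel-checked, weaker than expert review; nothing here is a statement
of the manuscript under review (Hironaka 2017); fact-free, counted 0.

CONTENT.  For valuation rings `W ≤ V` of `K` (a composite `W = V ∘ ν̄`):
* `valuation_lt_of_mul_inv_not_mem` / `valuation_le_of_mul_inv_not_mem` — a `W`-drop `y · x⁻¹ ∉ W` is a STRICT drop of the
  `W`-value and a WEAK drop of the `V`-value (`𝔪_V ⊆ 𝔪_W`);
* `directionalDescent_step` — each drop of the `StrictDrop` conclusion measured by `W` is `V`-dominating;
* `eventually_residueDrops` — along a sequence of successive `W`-drops inside a NOETHERIAN `V` the `V`-values are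
  eventually constant: the ratios are `V`-units outside `W`;
* `residue_not_mem_of_unit_not_mem` — and a `V`-unit outside `W` has residue OUTSIDE the residue valuation ring
  `ν̄ = W / 𝔪_V` of `κ(V)` (`Literature…residueValuationSubring`): the descent happens in the residue field, measured by `ν̄`.
-/

noncomputable section

-- single-problem summit: the doubled namespace component `ResolutionOfSingularities` is forced
set_option linter.dupNamespace false

namespace Summit.ResolutionOfSingularities.ResolutionOfSingularities.Theorems.NoZeno.CompositeDominator

open Summit.ResolutionOfSingularities.ResolutionOfSingularities.Theses.HomologicalConductor
open Summit.ResolutionOfSingularities.ResolutionOfSingularities.Theorems.NoZeno.Birth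
open Literature.AlgebraicGeometry.Resolution IsLocalRing

variable {k K : Type} [Field k] [Field K] [Algebra k K]

/-! ## §1 One drop: strict for `W`, weak for every coarsening `V ≥ W` -/

omit [Algebra k K] in
/-- A `W`-drop is a strict inequality of `W`-values: `y · x⁻¹ ∉ W`, `x ≠ 0` ⇒ `W.valuation x < W.valuation y`. [elementary] -/
theorem valuation_lt_of_mul_inv_not_mem (W : ValuationSubring K) {x y : K} (hx0 : x ≠ 0) (h : y * x⁻¹ ∉ W) :
    W.valuation x < W.valuation y := by
  have hlt : 1 < W.valuation (y * x⁻¹) := by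
    rw [← not_le, W.valuation_le_one_iff]
    exact h
  have hxv : W.valuation x ≠ 0 := by rw [ne_eq, Valuation.zero_iff]; exact hx0
  rw [map_mul, map_inv₀] at hlt
  calc W.valuation x = 1 * W.valuation x := (one_mul _).symm
    _ < W.valuation y * (W.valuation x)⁻¹ * W.valuation x := mul_lt_mul_of_pos_right hlt (zero_lt_iff.mpr hxv)
    _ = W.valuation y := inv_mul_cancel_right₀ hxv _

omit [Algebra k K] in
/-- **Coarsening monotonicity** (res-L0-w44-strat-1, `thread-composite` r1 §1b): for `W ≤ V`, a `W`-drop `y · x⁻¹ ∉ W`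
forces `V.valuation x ≤ V.valuation y` — the `V`-order does not increase — because `𝔪_V ⊆ 𝔪_W`
(Mathlib `ValuationSubring.nonunits_le_nonunits`). [elementary] -/
theorem valuation_le_of_mul_inv_not_mem (V W : ValuationSubring K) (hWV : W ≤ V) {x y : K} (hx0 : x ≠ 0)
    (h : y * x⁻¹ ∉ W) : V.valuation x ≤ V.valuation y := by
  by_contra hlt
  push Not at hlt
  apply h
  have hxv : V.valuation x ≠ 0 := by rw [ne_eq, Valuation.zero_iff]; exact hx0
  have hlt' : V.valuation (y * x⁻¹) < 1 := by
    rw [map_mul, map_inv₀]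
    calc V.valuation y * (V.valuation x)⁻¹ < V.valuation x * (V.valuation x)⁻¹ :=
          mul_lt_mul_of_pos_right hlt (inv_pos.mpr (zero_lt_iff.mpr hxv))
      _ = 1 := mul_inv_cancel₀ hxv
  exact W.nonunits_subset (ValuationSubring.nonunits_le_nonunits.mpr hWV (V.mem_nonunits_iff.mpr hlt'))

/-- **(DD), step form** (res-L0-w44-strat-1, r1 §1b): if the `StrictDrop` conclusion for the `O`-tower holds measured by
`W ≤ V`, each drop is `V`-DOMINATING — past every singular stage `m` some later `ca`-value `y` lies `W`-strictly below and
`V`-weakly below every nonzero `ca`-value of stage `m` (statement = r1 §1b verbatim, `DropsAlong O A W` unfolded as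
`hW`). [this work; elementary] -/
theorem directionalDescent_step (O : ValuationSubring K) (A : Subalgebra k K) (V W : ValuationSubring K)
    (hWV : W ≤ V)
    (hW : ∀ m : ℕ, ¬ IsRegularLocalRing ↥(tower O A m) →
      ∃ m' : ℕ, m < m' ∧ ∃ y ∈ ca (tower O A m'), y ≠ 0 ∧ ∀ x ∈ ca (tower O A m), x ≠ 0 → y * x⁻¹ ∉ W)
    (m : ℕ) (hm : ¬ IsRegularLocalRing ↥(tower O A m)) :
    ∃ m' : ℕ, m < m' ∧ ∃ y ∈ ca (tower O A m'), y ≠ 0 ∧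
      ∀ x ∈ ca (tower O A m), x ≠ 0 → y * x⁻¹ ∉ W ∧ V.valuation x ≤ V.valuation y := by
  obtain ⟨m', hmm', y, hy, hy0, hval⟩ := hW m hm
  exact ⟨m', hmm', y, hy, hy0, fun x hx hx0 =>
    ⟨hval x hx hx0, valuation_le_of_mul_inv_not_mem V W hWV hx0 (hval x hx hx0)⟩⟩

/-- (DD), step form with the STRICT `W`-inequality recorded as well. [this work; elementary] -/
theorem directionalDescent_step' (O : ValuationSubring K) (A : Subalgebra k K) (V W : ValuationSubring K)
    (hWV : W ≤ V)
    (hW : ∀ m : ℕ, ¬ IsRegularLocalRing ↥(tower O A m) →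
      ∃ m' : ℕ, m < m' ∧ ∃ y ∈ ca (tower O A m'), y ≠ 0 ∧ ∀ x ∈ ca (tower O A m), x ≠ 0 → y * x⁻¹ ∉ W)
    (m : ℕ) (hm : ¬ IsRegularLocalRing ↥(tower O A m)) :
    ∃ m' : ℕ, m < m' ∧ ∃ y ∈ ca (tower O A m'), y ≠ 0 ∧
      ∀ x ∈ ca (tower O A m), x ≠ 0 →
        y * x⁻¹ ∉ W ∧ W.valuation x < W.valuation y ∧ V.valuation x ≤ V.valuation y := by
  obtain ⟨m', hmm', y, hy, hy0, hval⟩ := hW m hm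
  exact ⟨m', hmm', y, hy, hy0, fun x hx hx0 =>
    ⟨hval x hx hx0, valuation_lt_of_mul_inv_not_mem W hx0 (hval x hx hx0),
      valuation_le_of_mul_inv_not_mem V W hWV hx0 (hval x hx hx0)⟩⟩

/-! ## §2 A chain of drops below a noetherian `V`: the `V`-values freeze, the descent moves to `κ(V)` -/

omit [Algebra k K] in
/-- **(DD), chain form** (res-L0-w44-strat-1, r1 §1b): if `y : ℕ → K` are nonzero elements of `V` with successive
`W`-drops `y (i+1) · (y i)⁻¹ ∉ W` (`W ≤ V`) and `V` is NOETHERIAN, then from some index on all `y i` have the same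
`V`-value and the ratios `y (i+1) · (y i)⁻¹` are `V`-units outside `W`.  Proof: the principal ideals `(y i)` of `V`
ascend (`valuation_le_of_mul_inv_not_mem`), hence stabilise. [this work; elementary] -/
theorem eventually_residueDrops (V W : ValuationSubring K) (hWV : W ≤ V) (hVN : IsNoetherianRing ↥V) (y : ℕ → K)
    (hyV : ∀ i, y i ∈ V) (hy0 : ∀ i, y i ≠ 0) (hdrop : ∀ i, y (i + 1) * (y i)⁻¹ ∉ W) :
    ∃ i₀ : ℕ, ∀ i, i₀ ≤ i →
      V.valuation (y (i + 1)) = V.valuation (y i) ∧ y (i + 1) * (y i)⁻¹ ∈ V ∧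
        V.valuation (y (i + 1) * (y i)⁻¹) = 1 ∧ y (i + 1) * (y i)⁻¹ ∉ W := by
  have hmono : ∀ i, V.valuation (y i) ≤ V.valuation (y (i + 1)) := fun i =>
    valuation_le_of_mul_inv_not_mem V W hWV (hy0 i) (hdrop i)
  have hv0 : ∀ i, V.valuation (y i) ≠ 0 := fun i => by rw [ne_eq, Valuation.zero_iff]; exact hy0 i
  -- the ascending chain of principal ideals `(y i) ⊆ (y (i+1))` of `V`
  let I : ℕ → Ideal ↥V := fun i => Ideal.span {(⟨y i, hyV i⟩ : ↥V)}
  have hI : ∀ i, I i ≤ I (i + 1) := by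
    intro i
    rw [Ideal.span_singleton_le_iff_mem, Ideal.mem_span_singleton']
    have hc : y i * (y (i + 1))⁻¹ ∈ V := by
      rw [← V.valuation_le_one_iff, map_mul, map_inv₀]
      calc V.valuation (y i) * (V.valuation (y (i + 1)))⁻¹
          ≤ V.valuation (y (i + 1)) * (V.valuation (y (i + 1)))⁻¹ :=
            mul_le_mul_of_nonneg_right (hmono i) (le_of_lt (inv_pos.mpr (zero_lt_iff.mpr (hv0 (i + 1)))))
        _ = 1 := mul_inv_cancel₀ (hv0 (i + 1))
    refine ⟨⟨y i * (y (i + 1))⁻¹, hc⟩, Subtype.ext ?_⟩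
    show y i * (y (i + 1))⁻¹ * y (i + 1) = y i
    rw [inv_mul_cancel_right₀ (hy0 (i + 1))]
  haveI : IsNoetherianRing ↥V := hVN
  obtain ⟨n, hn⟩ := (monotone_stabilizes_iff_noetherian.mpr (inferInstance : IsNoetherian ↥V ↥V))
    ⟨I, monotone_nat_of_le_succ hI⟩
  refine ⟨n, fun i hi => ?_⟩
  have hEq : I (i + 1) = I i := by
    have h1 := hn (i + 1) (hi.trans (Nat.le_succ i))
    have h2 := hn i hi
    simp only [OrderHom.coe_mk] at h1 h2
    rw [← h1, ← h2]
  have hmem : (⟨y (i + 1), hyV (i + 1)⟩ : ↥V) ∈ I i := by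
    rw [← hEq]
    exact Ideal.mem_span_singleton_self _
  obtain ⟨c, hc⟩ := Ideal.mem_span_singleton'.mp hmem
  have hcK : (c : K) * y i = y (i + 1) := by
    have := congrArg (fun z : ↥V => (z : K)) hc
    simpa using this
  have hle : V.valuation (y (i + 1)) ≤ V.valuation (y i) := by
    rw [← hcK, map_mul]
    calc V.valuation (c : K) * V.valuation (y i) ≤ 1 * V.valuation (y i) :=
          mul_le_mul_of_nonneg_right (V.valuation_le_one c) zero_le
      _ = V.valuation (y i) := one_mul _
  have heq : V.valuation (y (i + 1)) = V.valuation (y i) := le_antisymm hle (hmono i)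
  have hunit : V.valuation (y (i + 1) * (y i)⁻¹) = 1 := by
    rw [map_mul, map_inv₀, heq, mul_inv_cancel₀ (hv0 i)]
  exact ⟨heq, (V.valuation_le_one_iff _).mp hunit.le, hunit, hdrop i⟩

omit [Algebra k K] in
/-- **The descent is measured by `ν̄ = W / 𝔪_V`.**  For `W ≤ V` and `u ∈ V`: the residue of `u` in `κ(V)` lies in the residue
valuation ring of `W` iff `u ∈ W` (`Literature…residue_mem_residueValuationSubring_iff`); so a `V`-unit ratio outside `W`
(as produced by `eventually_residueDrops`) has residue OUTSIDE `ν̄`, i.e. of `ν̄`-value `> 1` — a pole of the residue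
valuation. [folklore] -/
theorem residue_not_mem_of_not_mem (V W : ValuationSubring K) (hWV : W ≤ V) {u : K} (huV : u ∈ V) (huW : u ∉ W) :
    residue ↥V ⟨u, huV⟩ ∉ residueValuationSubring W V hWV := by
  rw [residue_mem_residueValuationSubring_iff]
  exact huW

end Summit.ResolutionOfSingularities.ResolutionOfSingularities.Theorems.NoZeno.CompositeDominator

end
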